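import Summits.QuantumFields.BalabanUV.Beta.GAN24.DerivativeRateTransferCovariantLift

/-!
# `BalabanUV.Beta.GAN24.DerivativeRateTransferIncidenceLift` — binder row G-an2-4 ∕ (CONV-C), route R6 «VALUES, NOT DERIVATIVES», PART 34:
# (PROL) WITH A BACKGROUND, ONE DEGREE UP — the covariant intertwining identity BY SUBSTITUTION for ARBITRARY SIGNED INCIDENCES (bonds → plaquettes → cubes …),
# its holonomy-defect mass, and (PROL-ε,δ) from PART 28 for incidence «derivatives»
# (unit b2b-balaban-gan24-p3, gen 38; v1 — the shape of gan24-idea-1 g44's scratch (ε) `IncidenceLiftSketch` 47021691d3cf435a, Q-44-4, typed at its first refusal)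

NOT IN PRINT; OUR PROOF (for the ROUTE; [folklore] finite sums over ℝ + PART 27's Jensen letters + PART 28 `posSemidef_intertwine_jensen` + PART 33 BY NAME).
HONEST FRAMING (cell contract, verbatim): «discharging `BetaPertH` makes Bałaban's UV stability UNCONDITIONAL — a real constructive-QFT result; it is NOT the continuum
limit and NOT the Clay problem.»  HONEST DEPENDENCY (verbatim): «continuum YM on T⁴ ⇐ BetaPertH ∧ nine spine estimates (0/9 proved); BetaPertH ⇐ (D1) ∧ (D4) ∧
CAP+tail; G-an2-4 gates asym, D1 and NE2/3/4.»

WHY THIS FILE.  PART 33 lifts the FLAT intertwining identity of a prolongation to the covariant one in DEGREE 0 → 1 (site fields, bond differences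
`U_bu(tgt b) − u(src b)`).  Bałaban's fluctuation field is a 1-FORM whose «derivative» is the plaquette holonomy; route R6's U = 1 anchors are gan24-p2's 0-form
`MultilinearProlongation.energy_Pml_le` AND 1-form `CochainProlongation.plaq_Pco` ∕ `curlEnergy_Pco_le`.  The substitution is degree-agnostic (gan24-idea-1 g44,
(ε)): for ANY signed incidences `σ′ : P′ → X′ → ℝ` (fine cells over fine sites), `σ : P → X → ℝ` (coarse), IF the flat prolongation intertwines the incidence sums,
(L) `Σ_{x′} σ′(p′,x′)•Σ_k a(x′,k)•v_k = Σ_p q(p′,p)•Σ_x σ(p,x)•v_x` for every vector-valued `v`, THEN for ANY contour transports `O(x′,k)`, fine cell transports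
`T′(p′,x′)`, coarse cell transports `T(p,x)`, reference transports `R(p′,p)` and `Ō(p′,k)`:
`Σ_{x′} σ′(p′,x′)•T′(p′,x′)(P_O u)(x′) = Σ_p q(p′,p)•R(p′,p)·Σ_x σ(p,x)•T(p,x)u_x + E₁ u p′ + E₂ u p′`,
`E₁ = Σ_{x′} σ′•Σ_k a•(T′O − Ō)u_k` (fine holonomies minus one), `E₂ = Σ_p q•Σ_x σ•(Ō − R·T)u_x` (coarse holonomies minus one) — (L) at `v_k := Ō(p′,k)u_k`, and
subtract.  With ORTHOGONAL `R`, loop defects `κ₁` (on the support of `σ′·a`) and `κ₂` (on the support of `q·σ`), the ℓ¹ row masses `n′`, `n` of `σ′`, `σ`, the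
`a`-row sums ≤ 1, the `q`-row mass `ρ` and the two INCIDENCE COUNTS `γ₁ ≥ Σ_{x′}(Σ_{p′}|σ′(p′,x′)|)·a(x′,k)` (lattice: fine cells per fine site × hat mass = `c′·α′`) and
`γ₂ ≥ Σ_p (Σ_{p′}q(p′,p))·|σ(p,x)|` (lattice: `m·c`), the defect has mass `≤ K|u|²`, `K = 2κ₁²·n′·γ₁ + 2κ₂²·ρ·n·γ₂`, and PART 28 gives (PROL-ε,δ) for the incidence
derivatives `D_T u p = Σ_x σ(p,x)•T(p,x)u_x` (at the rescaled `ρ⁻¹q`, `ρ•D_T u`, `ρ⁻²w` — PART 33's S-44-1).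

WHAT THIS FILE PROVES (0 sorry, 0 `def`, nothing cited):
* §1 `assemble`, **`incidenceLift_of_flat`** (the identity; no smallness, no orthogonality — gan24-idea-1 g44's (ε), re-typed in these letters), `incidenceLift_degree_zero`
  (sanity: the two-point signed incidence sum is the bond difference).
* §2 `dotProduct_self_wsum_le_abs` (signed Jensen `|Σ c•w|² ≤ (Σ|c|)·Σ|c||w|²`), `wsum_opBound_le`, `wsum_abs_opBound_le` (Jensen against an operator bound ON THE
  SUPPORT of the weights), **`incidenceDefect_sq_le`** (one fine cell), **`sum_incidenceDefect_sq_le`** (`Σ_{p′}|E₁ + E₂|² ≤ (2κ₁²n′γ₁ + 2κ₂²ρnγ₂)|u|²`).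
* §3 **`prolGram_of_flat_incidence`** — (PROL-ε,δ) for incidence derivatives from (L), orthogonal `R`, the counts, the coarse form ABOVE `w·Σ_p|D_T u p|²`, the fine
  form BELOW `w′·Σ_{p′}|D′_{T′} v p′|²`, the slack condition `w′·m·ρ ≤ w` ⟹ for every `t > 0`: `((1 + t)•H + ((1 + t⁻¹)·w′·K)•1 − PᵀH′P).PosSemidef`;
  **`prolGram_of_flat_incidence_slack`** — the same with the background slack `+ λ|v|²` in the fine form (PART 33 §4's letter, `gram_le_colMass` BY NAME, orthogonal
  `O`, fine-site column count `α′`): `((1 + t)•H + ((1 + t⁻¹)·w′·K + λα′)•1 − PᵀH′P).PosSemidef`.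
WHAT IT DOES NOT DO: prove (L) for any prolongation (U = 1: p2's `plaq_Pco` over ℂ, `q = R⁻¹·icT`); feed `κ₁, κ₂`; identify `T′, T, R, O` with Bałaban's (S2(ii)).
SUPPLIER work on route R6 (rank 2, REDUCTION, no seat); no consumer of record; NEVER «G-an2-4 closed»; NOT (CONV-C), NOT D1, NOT `BetaPertH`, NOT continuum,
NOT Clay.  Records: `HOME/b2b-balaban-gan24-p3/WOODBURY-FIBRE.md` v13.8.
-/

noncomputable section

open Matrix Finset

namespace Summit.QuantumFields.BalabanUV.Beta.GAN24.DerivativeRateTransferIncidenceLift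

open Summit.QuantumFields.BalabanUV.Beta.GAN24.DerivativeRateTransferJensenChain
open Summit.QuantumFields.BalabanUV.Beta.GAN24.DerivativeRateTransferJensenIntertwine (posSemidef_intertwine_jensen)
open Summit.QuantumFields.BalabanUV.Beta.GAN24.DerivativeRateTransferCovariantLift

variable {o X X' C C' : Type*} [Fintype o] [DecidableEq o] [Fintype X] [Fintype X'] [Fintype C] [Fintype C']

/-! ## §1 The identity, any degree -/

section Identity

/-- abelian bookkeeping: `A = M + ((A − D) + (D − M))`. [folklore] -/
theorem assemble {G : Type*} [AddCommGroup G] (A D M : G) : A = M + ((A - D) + (D - M)) := by abel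

omit [DecidableEq o] [Fintype C'] in
/-- **`incidenceLift_of_flat` — THE COVARIANT INTERTWINING IDENTITY BY SUBSTITUTION, ANY DEGREE** [our proof; gan24-idea-1 g44's (ε)]: signed incidences
`σ′ : C′ → X′ → ℝ`, `σ : C → X → ℝ`; IF the flat prolongation intertwines the incidence sums, (L) `Σ_{x′} σ′(p′,x′)•Σ_k a(x′,k)•v_k = Σ_p q(p′,p)•Σ_x σ(p,x)•v_x`
for every `v : X → o → ℝ`, THEN for ANY `O, T′, T, R, Ō` and every `u`:
`Σ_{x′} σ′•T′(Σ_k a•O u_k) = Σ_p q•R(Σ_x σ•T u_x) + (Σ_{x′} σ′•Σ_k a•(T′O − Ō)u_k + Σ_p q•Σ_x σ•(Ō − RT)u_x)` — no smallness, no orthogonality. -/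
theorem incidenceLift_of_flat (a : X' → X → ℝ) (q : C' → C → ℝ) (σ' : C' → X' → ℝ) (σ : C → X → ℝ)
    (hL : ∀ (v : X → o → ℝ) (p' : C'), ∑ x', σ' p' x' • (∑ k, a x' k • v k) = ∑ p, q p' p • (∑ x, σ p x • v x))
    (O : X' → X → Matrix o o ℝ) (T' : C' → X' → Matrix o o ℝ) (T : C → X → Matrix o o ℝ) (R : C' → C → Matrix o o ℝ)
    (Obar : C' → X → Matrix o o ℝ) (u : X → o → ℝ) (p' : C') :
    ∑ x', σ' p' x' • (T' p' x' *ᵥ (∑ k, a x' k • (O x' k *ᵥ u k)))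
      = ∑ p, q p' p • (R p' p *ᵥ (∑ x, σ p x • (T p x *ᵥ u x)))
        + (∑ x', σ' p' x' • (∑ k, a x' k • ((T' p' x' * O x' k - Obar p' k) *ᵥ u k))
          + ∑ p, q p' p • (∑ x, σ p x • ((Obar p' x - R p' p * T p x) *ᵥ u x))) := by
  have F := hL (fun k => Obar p' k *ᵥ u k) p'
  have hA : ∑ x', σ' p' x' • (T' p' x' *ᵥ (∑ k, a x' k • (O x' k *ᵥ u k)))
      = ∑ x', σ' p' x' • (∑ k, a x' k • ((T' p' x' * O x' k) *ᵥ u k)) := by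
    refine Finset.sum_congr rfl fun x' _ => ?_
    rw [Matrix.mulVec_sum]
    congr 1
    exact Finset.sum_congr rfl fun k _ => by rw [Matrix.mulVec_smul, Matrix.mulVec_mulVec]
  have hM : ∑ p, q p' p • (R p' p *ᵥ (∑ x, σ p x • (T p x *ᵥ u x)))
      = ∑ p, q p' p • (∑ x, σ p x • ((R p' p * T p x) *ᵥ u x)) := by
    refine Finset.sum_congr rfl fun p _ => ?_
    rw [Matrix.mulVec_sum]
    congr 1
    exact Finset.sum_congr rfl fun x _ => by rw [Matrix.mulVec_smul, Matrix.mulVec_mulVec]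
  have hE1 : ∑ x', σ' p' x' • (∑ k, a x' k • ((T' p' x' * O x' k - Obar p' k) *ᵥ u k))
      = ∑ x', σ' p' x' • (∑ k, a x' k • ((T' p' x' * O x' k) *ᵥ u k))
        - ∑ x', σ' p' x' • (∑ k, a x' k • (Obar p' k *ᵥ u k)) := by
    simp only [Matrix.sub_mulVec, smul_sub, Finset.sum_sub_distrib]
  have hE2 : ∑ p, q p' p • (∑ x, σ p x • ((Obar p' x - R p' p * T p x) *ᵥ u x))
      = ∑ p, q p' p • (∑ x, σ p x • (Obar p' x *ᵥ u x))
        - ∑ p, q p' p • (∑ x, σ p x • ((R p' p * T p x) *ᵥ u x)) := by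
    simp only [Matrix.sub_mulVec, smul_sub, Finset.sum_sub_distrib]
  rw [hA, hM, hE1, hE2, ← F]
  exact assemble _ _ _

omit [Fintype o] [DecidableEq o] [Fintype X] [Fintype C] [Fintype C'] in
/-- **degree 0 recovered** (sanity): the two-point signed incidence sum is the bond difference. [folklore] -/
theorem incidenceLift_degree_zero [DecidableEq X'] (s t : X') (f : X' → o → ℝ) :
    ∑ x', ((if x' = t then (1 : ℝ) else 0) - (if x' = s then 1 else 0)) • f x' = f t - f s := by
  simp only [sub_smul, Finset.sum_sub_distrib, ite_smul, one_smul, zero_smul, Finset.sum_ite_eq', Finset.mem_univ, if_true]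

end Identity

/-! ## §2 The defect has mass `≤ K·|u|²` -/

section Defect

omit [DecidableEq o] in
/-- **SIGNED JENSEN** (no transport): real weights `c_x` ⟹ `|Σ_x c_x•w_x|² ≤ (Σ_x |c_x|)·Σ_x |c_x|·|w_x|²` (coordinatewise Cauchy–Schwarz with `r = c w`,
`f = |c|`, `g = |c| w²`). [folklore] -/
theorem dotProduct_self_wsum_le_abs {ν : Type*} (s : Finset ν) (c : ν → ℝ) (w : ν → o → ℝ) :
    (∑ x ∈ s, c x • w x) ⬝ᵥ (∑ x ∈ s, c x • w x) ≤ (∑ x ∈ s, |c x|) * ∑ x ∈ s, |c x| * (w x ⬝ᵥ w x) := by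
  have lhs : (∑ x ∈ s, c x • w x) ⬝ᵥ (∑ x ∈ s, c x • w x) = ∑ a, (∑ x ∈ s, c x * w x a) * (∑ x ∈ s, c x * w x a) := by
    simp only [dotProduct, Finset.sum_apply, Pi.smul_apply, smul_eq_mul]
  have rhs : (∑ x ∈ s, |c x|) * ∑ x ∈ s, |c x| * (w x ⬝ᵥ w x) = ∑ a, (∑ x ∈ s, |c x|) * ∑ x ∈ s, |c x| * (w x a * w x a) := by
    simp only [dotProduct, Finset.mul_sum]; exact Finset.sum_comm
  rw [lhs, rhs]
  refine Finset.sum_le_sum fun a _ => ?_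
  have hcs := Finset.sum_sq_le_sum_mul_sum_of_sq_le_mul s (r := fun x => c x * w x a) (f := fun x => |c x|)
    (g := fun x => |c x| * (w x a * w x a)) (fun x _ => abs_nonneg _) (fun x _ => mul_nonneg (abs_nonneg _) (mul_self_nonneg _))
    (fun x _ => by
      have h : |c x| * |c x| = c x * c x := abs_mul_abs_self _
      nlinarith [h])
  rw [sq] at hcs
  exact hcs

omit [DecidableEq o] in
/-- Jensen over nonnegative weights with row sum `≤ 1` against a pointwise operator bound on the support: `a_k ≥ 0`, `Σ a ≤ 1`,
`a_k ≠ 0 → |G_k w|² ≤ κ²|w|²` ⟹ `|Σ_k a_k•G_k u_k|² ≤ κ²·Σ_k a_k|u_k|²`. [folklore] -/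
theorem wsum_opBound_le {ν : Type*} [Fintype ν] {a : ν → ℝ} {G : ν → Matrix o o ℝ} {κ : ℝ} (ha0 : ∀ k, 0 ≤ a k) (ha1 : ∑ k, a k ≤ 1)
    (hG : ∀ k, a k ≠ 0 → ∀ w : o → ℝ, (G k *ᵥ w) ⬝ᵥ (G k *ᵥ w) ≤ κ ^ 2 * (w ⬝ᵥ w)) (u : ν → o → ℝ) :
    (∑ k, a k • (G k *ᵥ u k)) ⬝ᵥ (∑ k, a k • (G k *ᵥ u k)) ≤ κ ^ 2 * ∑ k, a k * (u k ⬝ᵥ u k) := by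
  refine (dotProduct_self_wsum_le' Finset.univ (fun k _ => ha0 k) ha1 fun k => G k *ᵥ u k).trans ?_
  rw [Finset.mul_sum]
  refine Finset.sum_le_sum fun k _ => ?_
  by_cases hk : a k = 0
  · simp [hk]
  · have := mul_le_mul_of_nonneg_left (hG k hk (u k)) (ha0 k)
    linarith [this]

omit [DecidableEq o] in
/-- Signed Jensen against a pointwise operator bound on the support: `Σ_x |c_x| ≤ n`, `c_x ≠ 0 → |G_x w|² ≤ κ²|w|²` ⟹
`|Σ_x c_x•G_x u_x|² ≤ n·κ²·Σ_x |c_x|·|u_x|²`. [folklore] -/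
theorem wsum_abs_opBound_le {ν : Type*} [Fintype ν] {c : ν → ℝ} {G : ν → Matrix o o ℝ} {κ n : ℝ} (hn : ∑ x, |c x| ≤ n)
    (hG : ∀ x, c x ≠ 0 → ∀ w : o → ℝ, (G x *ᵥ w) ⬝ᵥ (G x *ᵥ w) ≤ κ ^ 2 * (w ⬝ᵥ w)) (u : ν → o → ℝ) :
    (∑ x, c x • (G x *ᵥ u x)) ⬝ᵥ (∑ x, c x • (G x *ᵥ u x)) ≤ n * (κ ^ 2 * ∑ x, |c x| * (u x ⬝ᵥ u x)) := by
  refine (dotProduct_self_wsum_le_abs Finset.univ c fun x => G x *ᵥ u x).trans ?_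
  have h0 : 0 ≤ ∑ x, |c x| * ((G x *ᵥ u x) ⬝ᵥ (G x *ᵥ u x)) := Finset.sum_nonneg fun x _ => mul_nonneg (abs_nonneg _) (dotProduct_self_nonneg' _)
  have h1 : ∑ x, |c x| * ((G x *ᵥ u x) ⬝ᵥ (G x *ᵥ u x)) ≤ κ ^ 2 * ∑ x, |c x| * (u x ⬝ᵥ u x) := by
    rw [Finset.mul_sum]
    refine Finset.sum_le_sum fun x _ => ?_
    by_cases hx : c x = 0
    · simp [hx]
    · have := mul_le_mul_of_nonneg_left (hG x hx (u x)) (abs_nonneg (c x))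
      linarith [this]
  have hn0 : 0 ≤ n := (Finset.sum_nonneg fun x _ => abs_nonneg (c x)).trans hn
  calc (∑ x, |c x|) * ∑ x, |c x| * ((G x *ᵥ u x) ⬝ᵥ (G x *ᵥ u x)) ≤ n * ∑ x, |c x| * ((G x *ᵥ u x) ⬝ᵥ (G x *ᵥ u x)) :=
        mul_le_mul_of_nonneg_right hn h0
    _ ≤ n * (κ ^ 2 * ∑ x, |c x| * (u x ⬝ᵥ u x)) := mul_le_mul_of_nonneg_left h1 hn0

omit [DecidableEq o] [Fintype C'] in
/-- **`incidenceDefect_sq_le` — ONE FINE CELL**: `Σ_{x′}|σ′(p′,x′)| ≤ n′`, `a ≥ 0` with row sums `≤ 1`, `q(p′,·) ≥ 0` with row mass `≤ ρ`, `Σ_x|σ(p,x)| ≤ n`, loop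
defects on the supports `σ′(p′,x′) ≠ 0 ∧ a(x′,k) ≠ 0 → |(T′O − Ō)w|² ≤ κ₁²|w|²`, `q(p′,p) ≠ 0 ∧ σ(p,x) ≠ 0 → |(Ō − RT)w|² ≤ κ₂²|w|²` ⟹
`|E₁ + E₂|² ≤ 2n′κ₁²·Σ_{x′}|σ′(p′,x′)|·Σ_k a(x′,k)|u_k|² + 2ρnκ₂²·Σ_p q(p′,p)·Σ_x |σ(p,x)|·|u_x|²`. [our proof] -/
theorem incidenceDefect_sq_le {a : X' → X → ℝ} {q : C' → C → ℝ} {σ' : C' → X' → ℝ} {σ : C → X → ℝ}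
    {O : X' → X → Matrix o o ℝ} {T' : C' → X' → Matrix o o ℝ} {T : C → X → Matrix o o ℝ} {R : C' → C → Matrix o o ℝ}
    {Obar : C' → X → Matrix o o ℝ} {κ₁ κ₂ ρ n n' : ℝ} (p' : C')
    (hn' : ∑ x', |σ' p' x'| ≤ n') (ha0 : ∀ x' k, 0 ≤ a x' k) (ha1 : ∀ x', ∑ k, a x' k ≤ 1)
    (hq0 : ∀ p, 0 ≤ q p' p) (hq1 : ∑ p, q p' p ≤ ρ) (hn : ∀ p, ∑ x, |σ p x| ≤ n)
    (hκ₁ : ∀ x' k, σ' p' x' ≠ 0 → a x' k ≠ 0 → ∀ w : o → ℝ,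
      ((T' p' x' * O x' k - Obar p' k) *ᵥ w) ⬝ᵥ ((T' p' x' * O x' k - Obar p' k) *ᵥ w) ≤ κ₁ ^ 2 * (w ⬝ᵥ w))
    (hκ₂ : ∀ p x, q p' p ≠ 0 → σ p x ≠ 0 → ∀ w : o → ℝ,
      ((Obar p' x - R p' p * T p x) *ᵥ w) ⬝ᵥ ((Obar p' x - R p' p * T p x) *ᵥ w) ≤ κ₂ ^ 2 * (w ⬝ᵥ w)) (u : X → o → ℝ) :
    (∑ x', σ' p' x' • (∑ k, a x' k • ((T' p' x' * O x' k - Obar p' k) *ᵥ u k))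
        + ∑ p, q p' p • (∑ x, σ p x • ((Obar p' x - R p' p * T p x) *ᵥ u x))) ⬝ᵥ
      (∑ x', σ' p' x' • (∑ k, a x' k • ((T' p' x' * O x' k - Obar p' k) *ᵥ u k))
        + ∑ p, q p' p • (∑ x, σ p x • ((Obar p' x - R p' p * T p x) *ᵥ u x))) ≤
      2 * (n' * (κ₁ ^ 2 * ∑ x', |σ' p' x'| * ∑ k, a x' k * (u k ⬝ᵥ u k)))
        + 2 * (ρ * (n * (κ₂ ^ 2 * ∑ p, q p' p * ∑ x, |σ p x| * (u x ⬝ᵥ u x)))) := by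
  refine (dotProduct_self_two_add_le _ _).trans ?_
  -- first defect: signed Jensen over `x′`, then Jensen over `a(x′,·)` with the loop bound on the support
  have h1 := dotProduct_self_wsum_le_abs Finset.univ (σ' p') fun x' => ∑ k, a x' k • ((T' p' x' * O x' k - Obar p' k) *ᵥ u k)
  have h1a : ∀ x', |σ' p' x'| * ((∑ k, a x' k • ((T' p' x' * O x' k - Obar p' k) *ᵥ u k)) ⬝ᵥ
      (∑ k, a x' k • ((T' p' x' * O x' k - Obar p' k) *ᵥ u k))) ≤ |σ' p' x'| * (κ₁ ^ 2 * ∑ k, a x' k * (u k ⬝ᵥ u k)) := by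
    intro x'
    by_cases hx : σ' p' x' = 0
    · simp [hx]
    · exact mul_le_mul_of_nonneg_left (wsum_opBound_le (ha0 x') (ha1 x') (fun k hk => hκ₁ x' k hx hk) u) (abs_nonneg _)
  have h1b : (∑ x', |σ' p' x'|) * ∑ x', |σ' p' x'| * ((∑ k, a x' k • ((T' p' x' * O x' k - Obar p' k) *ᵥ u k)) ⬝ᵥ
      (∑ k, a x' k • ((T' p' x' * O x' k - Obar p' k) *ᵥ u k))) ≤ n' * (κ₁ ^ 2 * ∑ x', |σ' p' x'| * ∑ k, a x' k * (u k ⬝ᵥ u k)) := by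
    have hs0 : 0 ≤ ∑ x', |σ' p' x'| * ((∑ k, a x' k • ((T' p' x' * O x' k - Obar p' k) *ᵥ u k)) ⬝ᵥ
        (∑ k, a x' k • ((T' p' x' * O x' k - Obar p' k) *ᵥ u k))) :=
      Finset.sum_nonneg fun x' _ => mul_nonneg (abs_nonneg _) (dotProduct_self_nonneg' _)
    have hn'0 : 0 ≤ n' := (Finset.sum_nonneg fun x' _ => abs_nonneg (σ' p' x')).trans hn'
    calc (∑ x', |σ' p' x'|) * ∑ x', |σ' p' x'| * ((∑ k, a x' k • ((T' p' x' * O x' k - Obar p' k) *ᵥ u k)) ⬝ᵥ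
          (∑ k, a x' k • ((T' p' x' * O x' k - Obar p' k) *ᵥ u k)))
        ≤ n' * ∑ x', |σ' p' x'| * ((∑ k, a x' k • ((T' p' x' * O x' k - Obar p' k) *ᵥ u k)) ⬝ᵥ
          (∑ k, a x' k • ((T' p' x' * O x' k - Obar p' k) *ᵥ u k))) := mul_le_mul_of_nonneg_right hn' hs0
      _ ≤ n' * ∑ x', |σ' p' x'| * (κ₁ ^ 2 * ∑ k, a x' k * (u k ⬝ᵥ u k)) := mul_le_mul_of_nonneg_left (Finset.sum_le_sum fun x' _ => h1a x') hn'0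
      _ = n' * (κ₁ ^ 2 * ∑ x', |σ' p' x'| * ∑ k, a x' k * (u k ⬝ᵥ u k)) := by
          congr 1; rw [Finset.mul_sum]; exact Finset.sum_congr rfl fun x' _ => by ring
  -- second defect: Jensen over `q(p′,·)` (row mass ρ), then signed Jensen over `x` with the loop bound on the support
  have h2 := dotProduct_self_wsum_le_mass Finset.univ (fun p _ => hq0 p) hq1 fun p => ∑ x, σ p x • ((Obar p' x - R p' p * T p x) *ᵥ u x)
  have h2a : ∀ p, q p' p * ((∑ x, σ p x • ((Obar p' x - R p' p * T p x) *ᵥ u x)) ⬝ᵥ (∑ x, σ p x • ((Obar p' x - R p' p * T p x) *ᵥ u x)))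
      ≤ q p' p * (n * (κ₂ ^ 2 * ∑ x, |σ p x| * (u x ⬝ᵥ u x))) := by
    intro p
    by_cases hp : q p' p = 0
    · simp [hp]
    · exact mul_le_mul_of_nonneg_left (wsum_abs_opBound_le (hn p) (fun x hx => hκ₂ p x hp hx) u) (hq0 p)
  have hρ : 0 ≤ ρ := (Finset.sum_nonneg fun p _ => hq0 p).trans hq1
  have h2b : ρ * ∑ p, q p' p * ((∑ x, σ p x • ((Obar p' x - R p' p * T p x) *ᵥ u x)) ⬝ᵥ
      (∑ x, σ p x • ((Obar p' x - R p' p * T p x) *ᵥ u x))) ≤ ρ * (n * (κ₂ ^ 2 * ∑ p, q p' p * ∑ x, |σ p x| * (u x ⬝ᵥ u x))) := by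
    refine mul_le_mul_of_nonneg_left ?_ hρ
    refine (Finset.sum_le_sum fun p _ => h2a p).trans (le_of_eq ?_)
    rw [Finset.mul_sum, Finset.mul_sum]
    exact Finset.sum_congr rfl fun p _ => by ring
  linarith [h1, h1b, h2, h2b]

omit [DecidableEq o] in
/-- **`sum_incidenceDefect_sq_le` — ALL FINE CELLS**: with the INCIDENCE COUNTS `γ₁ ≥ Σ_{x′}(Σ_{p′}|σ′(p′,x′)|)·a(x′,k)` (fine cells through the fine sites
above `k`, hat-weighted) and `γ₂ ≥ Σ_p (Σ_{p′} q(p′,p))·|σ(p,x)|` (coarse cells through `x`, weighted by the column mass of `q`), `0 ≤ n′`, `0 ≤ ρ`, `0 ≤ n`, the per-cell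
bounds sum to `Σ_{p′}|E u p′|² ≤ (2κ₁²n′γ₁ + 2κ₂²ρnγ₂)·|u|²`. [our proof] -/
theorem sum_incidenceDefect_sq_le {a : X' → X → ℝ} {q : C' → C → ℝ} {σ' : C' → X' → ℝ} {σ : C → X → ℝ} {κ₁ κ₂ ρ n n' γ₁ γ₂ : ℝ}
    {E : C' → o → ℝ} (u : X → o → ℝ) (hn'0 : 0 ≤ n') (hρ : 0 ≤ ρ) (hn0 : 0 ≤ n)
    (hE : ∀ p', E p' ⬝ᵥ E p' ≤ 2 * (n' * (κ₁ ^ 2 * ∑ x', |σ' p' x'| * ∑ k, a x' k * (u k ⬝ᵥ u k)))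
        + 2 * (ρ * (n * (κ₂ ^ 2 * ∑ p, q p' p * ∑ x, |σ p x| * (u x ⬝ᵥ u x)))))
    (hγ₁ : ∀ k, ∑ x', (∑ p', |σ' p' x'|) * a x' k ≤ γ₁) (hγ₂ : ∀ x, ∑ p, (∑ p', q p' p) * |σ p x| ≤ γ₂) :
    ∑ p', E p' ⬝ᵥ E p' ≤ (2 * κ₁ ^ 2 * n' * γ₁ + 2 * κ₂ ^ 2 * ρ * n * γ₂) * ∑ k, u k ⬝ᵥ u k := by
  have huk : ∀ k, 0 ≤ u k ⬝ᵥ u k := fun k => dotProduct_self_nonneg' _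
  have hS1 : ∑ p', ∑ x', |σ' p' x'| * ∑ k, a x' k * (u k ⬝ᵥ u k) = ∑ k, (∑ x', (∑ p', |σ' p' x'|) * a x' k) * (u k ⬝ᵥ u k) := by
    simp only [Finset.sum_mul, Finset.mul_sum, mul_assoc]
    rw [Finset.sum_comm]
    refine (Finset.sum_congr rfl fun x' _ => Finset.sum_comm).trans ?_
    rw [Finset.sum_comm]
  have hS2 : ∑ p', ∑ p, q p' p * ∑ x, |σ p x| * (u x ⬝ᵥ u x) = ∑ x, (∑ p, (∑ p', q p' p) * |σ p x|) * (u x ⬝ᵥ u x) := by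
    simp only [Finset.sum_mul, Finset.mul_sum, mul_assoc]
    rw [Finset.sum_comm]
    refine (Finset.sum_congr rfl fun p _ => Finset.sum_comm).trans ?_
    rw [Finset.sum_comm]
  have hA : ∑ p', ∑ x', |σ' p' x'| * ∑ k, a x' k * (u k ⬝ᵥ u k) ≤ γ₁ * ∑ k, u k ⬝ᵥ u k := by
    rw [hS1, Finset.mul_sum]
    exact Finset.sum_le_sum fun k _ => mul_le_mul_of_nonneg_right (hγ₁ k) (huk k)
  have hB : ∑ p', ∑ p, q p' p * ∑ x, |σ p x| * (u x ⬝ᵥ u x) ≤ γ₂ * ∑ k, u k ⬝ᵥ u k := by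
    rw [hS2, Finset.mul_sum]
    exact Finset.sum_le_sum fun x _ => mul_le_mul_of_nonneg_right (hγ₂ x) (huk x)
  calc ∑ p', E p' ⬝ᵥ E p'
      ≤ ∑ p', (2 * (n' * (κ₁ ^ 2 * ∑ x', |σ' p' x'| * ∑ k, a x' k * (u k ⬝ᵥ u k)))
          + 2 * (ρ * (n * (κ₂ ^ 2 * ∑ p, q p' p * ∑ x, |σ p x| * (u x ⬝ᵥ u x))))) := Finset.sum_le_sum fun p' _ => hE p'
    _ = 2 * (n' * (κ₁ ^ 2 * ∑ p', ∑ x', |σ' p' x'| * ∑ k, a x' k * (u k ⬝ᵥ u k)))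
          + 2 * (ρ * (n * (κ₂ ^ 2 * ∑ p', ∑ p, q p' p * ∑ x, |σ p x| * (u x ⬝ᵥ u x)))) := by
        rw [Finset.sum_add_distrib, Finset.mul_sum, Finset.mul_sum, Finset.mul_sum, Finset.mul_sum, Finset.mul_sum, Finset.mul_sum, Finset.mul_sum]
    _ ≤ 2 * (n' * (κ₁ ^ 2 * (γ₁ * ∑ k, u k ⬝ᵥ u k))) + 2 * (ρ * (n * (κ₂ ^ 2 * (γ₂ * ∑ k, u k ⬝ᵥ u k)))) := by
        have h1 := mul_le_mul_of_nonneg_left hA (sq_nonneg κ₁)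
        have h2 := mul_le_mul_of_nonneg_left hB (sq_nonneg κ₂)
        have h1' := mul_le_mul_of_nonneg_left h1 hn'0
        have h2' := mul_le_mul_of_nonneg_left (mul_le_mul_of_nonneg_left h2 hn0) hρ
        linarith
    _ = (2 * κ₁ ^ 2 * n' * γ₁ + 2 * κ₂ ^ 2 * ρ * n * γ₂) * ∑ k, u k ⬝ᵥ u k := by ring

end Defect

/-! ## §3 (PROL-ε,δ) for incidence derivatives, from the flat identity -/

section Prol

variable [DecidableEq X]

/-- **`prolGram_of_flat_incidence` — (PROL-ε,δ) FOR INCIDENCE DERIVATIVES FROM THE FLAT INTERTWINING IDENTITY** [our proof; PART 28 `posSemidef_intertwine_jensen` with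
`(X, Y, Q) := (X × o, X′ × o, P)`, indices the CELLS `C, C′`, transport `R`, at the rescaled weights `ρ⁻¹q` and derivatives `ρ•D_T u` (PART 33's S-44-1 rescaling)]:
structure `hP` of the covariant prolongation, the flat identity (L) for the incidence sums, orthogonal `R` and `O`, `q ≥ 0` of row mass `≤ ρ` (`0 < ρ`) and column sums
`≤ m`, `a ≥ 0` of row sums `≤ 1`, the ℓ¹ row masses `n′`, `n` of `σ′`, `σ` (`0 ≤ n′`, `0 ≤ n`), the incidence counts `γ₁`, `γ₂` of §2, loop defects `κ₁`, `κ₂` ON THE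
SUPPORTS, the coarse form ABOVE `w·Σ_p|D_T u p|²` (`D_T u p = Σ_x σ(p,x)•T(p,x)u_x`), the fine form BELOW `w′·Σ_{p′}|D′_{T′} v p′|²`, `0 ≤ w′`, the slack condition
`w′·m·ρ ≤ w`, `H, H′` symmetric ⟹ for every `t > 0`: `((1 + t)•H + ((1 + t⁻¹)·w′·(2κ₁²n′γ₁ + 2κ₂²ρnγ₂))•1 − PᵀH′P).PosSemidef`. -/
theorem prolGram_of_flat_incidence {a : X' → X → ℝ} {q : C' → C → ℝ} {σ' : C' → X' → ℝ} {σ : C → X → ℝ}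
    {O : X' → X → Matrix o o ℝ} {T' : C' → X' → Matrix o o ℝ} {T : C → X → Matrix o o ℝ} {R : C' → C → Matrix o o ℝ} {Obar : C' → X → Matrix o o ℝ}
    {P : Matrix (X' × o) (X × o) ℝ} {H : Matrix (X × o) (X × o) ℝ} {H' : Matrix (X' × o) (X' × o) ℝ} {κ₁ κ₂ ρ m n n' γ₁ γ₂ w w' : ℝ}
    (hP : ∀ (u : X × o → ℝ) (x' : X'), (fun i => (P *ᵥ u) (x', i)) = ∑ k, a x' k • (O x' k *ᵥ fun i => u (k, i)))
    (hL : ∀ (v : X → o → ℝ) (p' : C'), ∑ x', σ' p' x' • (∑ k, a x' k • v k) = ∑ p, q p' p • (∑ x, σ p x • v x))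
    (hR : ∀ p' p, (R p' p)ᵀ * R p' p = 1) (hρ : 0 < ρ)
    (hq0 : ∀ p' p, 0 ≤ q p' p) (hq1 : ∀ p', ∑ p, q p' p ≤ ρ) (hqcol : ∀ p, ∑ p', q p' p ≤ m)
    (ha0 : ∀ x' k, 0 ≤ a x' k) (ha1 : ∀ x', ∑ k, a x' k ≤ 1)
    (hn' : ∀ p', ∑ x', |σ' p' x'| ≤ n') (hn'0 : 0 ≤ n') (hn : ∀ p, ∑ x, |σ p x| ≤ n) (hn0 : 0 ≤ n)
    (hγ₁ : ∀ k, ∑ x', (∑ p', |σ' p' x'|) * a x' k ≤ γ₁) (hγ₂ : ∀ x, ∑ p, (∑ p', q p' p) * |σ p x| ≤ γ₂)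
    (hκ₁ : ∀ p' x' k, σ' p' x' ≠ 0 → a x' k ≠ 0 → ∀ w : o → ℝ,
      ((T' p' x' * O x' k - Obar p' k) *ᵥ w) ⬝ᵥ ((T' p' x' * O x' k - Obar p' k) *ᵥ w) ≤ κ₁ ^ 2 * (w ⬝ᵥ w))
    (hκ₂ : ∀ p' p x, q p' p ≠ 0 → σ p x ≠ 0 → ∀ w : o → ℝ,
      ((Obar p' x - R p' p * T p x) *ᵥ w) ⬝ᵥ ((Obar p' x - R p' p * T p x) *ᵥ w) ≤ κ₂ ^ 2 * (w ⬝ᵥ w))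
    (hHs : Hᵀ = H) (hH's : H'ᵀ = H') (hw' : 0 ≤ w') (hw : w' * m * ρ ≤ w)
    (hH : ∀ u : X × o → ℝ,
      w * ∑ p, (∑ x, σ p x • (T p x *ᵥ fun i => u (x, i))) ⬝ᵥ (∑ x, σ p x • (T p x *ᵥ fun i => u (x, i))) ≤ u ⬝ᵥ (H *ᵥ u))
    (hH' : ∀ v : X' × o → ℝ,
      v ⬝ᵥ (H' *ᵥ v) ≤ w' * ∑ p', (∑ x', σ' p' x' • (T' p' x' *ᵥ fun i => v (x', i))) ⬝ᵥ (∑ x', σ' p' x' • (T' p' x' *ᵥ fun i => v (x', i))))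
    {t : ℝ} (ht : 0 < t) :
    ((1 + t) • H + ((1 + t⁻¹) * w' * (2 * κ₁ ^ 2 * n' * γ₁ + 2 * κ₂ ^ 2 * ρ * n * γ₂)) • (1 : Matrix (X × o) (X × o) ℝ) - Pᵀ * H' * P).PosSemidef := by
  have hρ0 : ρ ≠ 0 := hρ.ne'
  have hρi : 0 ≤ ρ⁻¹ := inv_nonneg.mpr hρ.le
  refine posSemidef_intertwine_jensen (P' := C') (P := C) (X := X × o) (Y := X' × o) (q := fun p' p => ρ⁻¹ * q p' p) (m := ρ⁻¹ * m)
    (wf := ρ⁻¹ * ρ⁻¹ * w) (W := R)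
    (D := fun u p => ρ • ∑ x, σ p x • (T p x *ᵥ fun i => u (x, i)))
    (D' := fun v p' => ∑ x', σ' p' x' • (T' p' x' *ᵥ fun i => v (x', i)))
    (Eu := fun u p' => ∑ x', σ' p' x' • (∑ k, a x' k • ((T' p' x' * O x' k - Obar p' k) *ᵥ fun i => u (k, i)))
      + ∑ p, q p' p • (∑ x, σ p x • ((Obar p' x - R p' p * T p x) *ᵥ fun i => u (x, i))))
    (fun p' p => mul_nonneg hρi (hq0 p' p)) (fun p' => ?_) hR (fun p => ?_) hw' ?_ hHs hH's (fun u => ?_) hH' (fun u p' => ?_)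
    (fun u => ?_) ht
  · rw [← Finset.mul_sum]
    calc ρ⁻¹ * ∑ p, q p' p ≤ ρ⁻¹ * ρ := mul_le_mul_of_nonneg_left (hq1 p') hρi
      _ = 1 := inv_mul_cancel₀ hρ0
  · rw [← Finset.mul_sum]
    exact mul_le_mul_of_nonneg_left (hqcol p) hρi
  · have e : w' * (ρ⁻¹ * m) = ρ⁻¹ * ρ⁻¹ * (w' * m * ρ) := by field_simp
    rw [e]
    exact mul_le_mul_of_nonneg_left hw (mul_nonneg hρi hρi)
  · rw [sum_smul_dotProduct_smul]
    have e : ∀ S : ℝ, ρ⁻¹ * ρ⁻¹ * w * (ρ * ρ * S) = w * S := fun S => by field_simp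
    rw [e]
    exact hH u
  · -- the intertwining identity is §1 at `u_k := (i ↦ u (k, i))`, rescaled
    rw [sum_rescale_smul_mulVec hρ0]
    have h1 := incidenceLift_of_flat a q σ' σ hL O T' T R Obar (fun k => fun i => u (k, i)) p'
    rw [← h1]
    exact Finset.sum_congr rfl fun x' _ => by rw [hP u x']
  · have h := sum_incidenceDefect_sq_le
      (E := fun p' => ∑ x', σ' p' x' • (∑ k, a x' k • ((T' p' x' * O x' k - Obar p' k) *ᵥ fun i => u (k, i)))
        + ∑ p, q p' p • (∑ x, σ p x • ((Obar p' x - R p' p * T p x) *ᵥ fun i => u (x, i))))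
      (fun k => fun i => u (k, i)) hn'0 hρ.le hn0
      (fun p' => incidenceDefect_sq_le p' (hn' p') ha0 ha1 (hq0 p') (hq1 p') hn (hκ₁ p') (hκ₂ p') fun k => fun i => u (k, i)) hγ₁ hγ₂
    rw [dotProduct_self_eq_sum_curry u]
    exact h

/-- **`prolGram_of_flat_incidence_slack`** — the same with a background slack `λ|v|²` in the fine form (PART 33 §4's letter; `gram_le_colMass` BY NAME with the
fine-site column count `Σ_{x′} a(x′,k) ≤ α′`): `((1 + t)•H + ((1 + t⁻¹)·w′·(2κ₁²n′γ₁ + 2κ₂²ρnγ₂) + λα′)•1 − PᵀH′P).PosSemidef`. [our proof] -/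
theorem prolGram_of_flat_incidence_slack [DecidableEq X'] {a : X' → X → ℝ} {q : C' → C → ℝ} {σ' : C' → X' → ℝ} {σ : C → X → ℝ}
    {O : X' → X → Matrix o o ℝ} {T' : C' → X' → Matrix o o ℝ} {T : C → X → Matrix o o ℝ} {R : C' → C → Matrix o o ℝ} {Obar : C' → X → Matrix o o ℝ}
    {P : Matrix (X' × o) (X × o) ℝ} {H : Matrix (X × o) (X × o) ℝ} {H' : Matrix (X' × o) (X' × o) ℝ} {κ₁ κ₂ ρ α' m n n' γ₁ γ₂ w w' lam : ℝ}
    (hP : ∀ (u : X × o → ℝ) (x' : X'), (fun i => (P *ᵥ u) (x', i)) = ∑ k, a x' k • (O x' k *ᵥ fun i => u (k, i)))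
    (hL : ∀ (v : X → o → ℝ) (p' : C'), ∑ x', σ' p' x' • (∑ k, a x' k • v k) = ∑ p, q p' p • (∑ x, σ p x • v x))
    (hR : ∀ p' p, (R p' p)ᵀ * R p' p = 1) (hO : ∀ x' k, (O x' k)ᵀ * O x' k = 1) (hρ : 0 < ρ)
    (hq0 : ∀ p' p, 0 ≤ q p' p) (hq1 : ∀ p', ∑ p, q p' p ≤ ρ) (hqcol : ∀ p, ∑ p', q p' p ≤ m)
    (ha0 : ∀ x' k, 0 ≤ a x' k) (ha1 : ∀ x', ∑ k, a x' k ≤ 1) (hacol' : ∀ k, ∑ x', a x' k ≤ α')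
    (hn' : ∀ p', ∑ x', |σ' p' x'| ≤ n') (hn'0 : 0 ≤ n') (hn : ∀ p, ∑ x, |σ p x| ≤ n) (hn0 : 0 ≤ n)
    (hγ₁ : ∀ k, ∑ x', (∑ p', |σ' p' x'|) * a x' k ≤ γ₁) (hγ₂ : ∀ x, ∑ p, (∑ p', q p' p) * |σ p x| ≤ γ₂)
    (hκ₁ : ∀ p' x' k, σ' p' x' ≠ 0 → a x' k ≠ 0 → ∀ w : o → ℝ,
      ((T' p' x' * O x' k - Obar p' k) *ᵥ w) ⬝ᵥ ((T' p' x' * O x' k - Obar p' k) *ᵥ w) ≤ κ₁ ^ 2 * (w ⬝ᵥ w))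
    (hκ₂ : ∀ p' p x, q p' p ≠ 0 → σ p x ≠ 0 → ∀ w : o → ℝ,
      ((Obar p' x - R p' p * T p x) *ᵥ w) ⬝ᵥ ((Obar p' x - R p' p * T p x) *ᵥ w) ≤ κ₂ ^ 2 * (w ⬝ᵥ w))
    (hHs : Hᵀ = H) (hH's : H'ᵀ = H') (hw' : 0 ≤ w') (hw : w' * m * ρ ≤ w) (hlam : 0 ≤ lam)
    (hH : ∀ u : X × o → ℝ,
      w * ∑ p, (∑ x, σ p x • (T p x *ᵥ fun i => u (x, i))) ⬝ᵥ (∑ x, σ p x • (T p x *ᵥ fun i => u (x, i))) ≤ u ⬝ᵥ (H *ᵥ u))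
    (hH' : ∀ v : X' × o → ℝ,
      v ⬝ᵥ (H' *ᵥ v) ≤ w' * ∑ p', (∑ x', σ' p' x' • (T' p' x' *ᵥ fun i => v (x', i))) ⬝ᵥ (∑ x', σ' p' x' • (T' p' x' *ᵥ fun i => v (x', i)))
        + lam * (v ⬝ᵥ v))
    {t : ℝ} (ht : 0 < t) :
    ((1 + t) • H + ((1 + t⁻¹) * w' * (2 * κ₁ ^ 2 * n' * γ₁ + 2 * κ₂ ^ 2 * ρ * n * γ₂) + lam * α') • (1 : Matrix (X × o) (X × o) ℝ)
      - Pᵀ * H' * P).PosSemidef := by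
  have hH's' : (H' - lam • (1 : Matrix (X' × o) (X' × o) ℝ))ᵀ = H' - lam • 1 := by
    rw [transpose_sub, transpose_smul, transpose_one, hH's]
  have hH'' : ∀ v : X' × o → ℝ, v ⬝ᵥ ((H' - lam • (1 : Matrix (X' × o) (X' × o) ℝ)) *ᵥ v) ≤
      w' * ∑ p', (∑ x', σ' p' x' • (T' p' x' *ᵥ fun i => v (x', i))) ⬝ᵥ (∑ x', σ' p' x' • (T' p' x' *ᵥ fun i => v (x', i))) := by
    intro v
    rw [sub_mulVec, smul_mulVec, one_mulVec, dotProduct_sub, dotProduct_smul, smul_eq_mul]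
    linarith [hH' v]
  have h3 := prolGram_of_flat_incidence hP hL hR hρ hq0 hq1 hqcol ha0 ha1 hn' hn'0 hn hn0 hγ₁ hγ₂ hκ₁ hκ₂ hHs hH's' hw' hw hH hH'' ht
  have h4 := (gram_le_colMass hP hO ha0 ha1 hacol').smul hlam
  have e : (1 + t) • H + ((1 + t⁻¹) * w' * (2 * κ₁ ^ 2 * n' * γ₁ + 2 * κ₂ ^ 2 * ρ * n * γ₂) + lam * α') • (1 : Matrix (X × o) (X × o) ℝ) - Pᵀ * H' * P
      = ((1 + t) • H + ((1 + t⁻¹) * w' * (2 * κ₁ ^ 2 * n' * γ₁ + 2 * κ₂ ^ 2 * ρ * n * γ₂)) • (1 : Matrix (X × o) (X × o) ℝ)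
          - Pᵀ * (H' - lam • (1 : Matrix (X' × o) (X' × o) ℝ)) * P)
        + lam • (α' • (1 : Matrix (X × o) (X × o) ℝ) - Pᵀ * P) := by
    rw [Matrix.mul_sub, Matrix.sub_mul, Matrix.mul_smul, Matrix.smul_mul, Matrix.mul_one, smul_sub, smul_smul]
    simp only [add_smul]
    abel
  rw [e]
  exact h3.add h4

end Prol

end Summit.QuantumFields.BalabanUV.Beta.GAN24.DerivativeRateTransferIncidenceLift

end
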